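import Literature.Geometry.Symplectic.PencilEndInterceptChart
import Literature.Geometry.Symplectic.PencilEndLeafParam
import Literature.Geometry.Symplectic.PencilEndLeafMember
import Literature.Geometry.Symplectic.PencilEndLeafJoint
import Literature.Geometry.Symplectic.JPlanePencilFamilyOrientation
import HarnessLib

/-!
# The local family of pencil members read off from the leaves of the blown-up end

Support file (no new facts, D-0026) for the glue
`jPlanePencil_localFamily_homotopySphere ⟸ hls_localFoliation_embeddedSphere_trivialNormal`
(C. Wendl, *Holomorphic Curves in Low Dimensions* (2018), proof of Prop. 2.53, p. 65: "the
members of the pencil near `u₀` are the leaves, minus their points on the exceptional sphere, of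
the local `2`-parameter family of embedded `JY`-spheres of the blown-up end through the
compactified member; the intercept is a chart of the family").

`PencilEnd.exists_leafFloc`. Given the blown-up end `G : PencilEnd p`, a member `u₀` of
intercept `b₀` (`‖b₀ - G.b₀‖ < ρ'`) and a family `(U a, V a)`, `‖a‖ < ε`, of embedded
`JY`-holomorphic two-chart spheres of `Y` through `(memberU u₀, memberV u₀ b₀)` at `a = 0`,
jointly smooth with jointly immersive evaluation maps (the existence half of the HLS fact in `Y`),
we construct `Floc : ℂ → ℂ → M ∖ p` and `δ' > 0` with `Floc b₀ = u₀`, `Floc b` a member of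
intercept `b` for `b ∈ ball b₀ δ'`, jointly `C^∞` in `(b, ξ)` with injective differential, with a
UNIFORM STANDARD END and `C^∞` BLOW-UP COORDINATES `famXW p Floc` on `ball b₀ δ' ×ˢ ball 0 rI`
(the regularity package `hE` of `jPlanePencil_localFamily_homotopySphere_of_compactifiedFamily`),
and `range (inP ∘ Floc b) = leaf ∩ range inP`.

Construction (the summit-side `stub_leafFloc`, `Summits/SmoothPoincare4/…/SullivanDualWitness
ChargeV15LeafFloc.lean`, transported to `G.Y`, plus the blow-up regularity): with the intercept
chart `(ε₁, r₁, r₂, δ, wz, α, β)` of `PencilEnd.exists_interceptChart`, for the leaf `a = α b` let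
`w₀ = wz a`, `g_a w = (boxCoord (V a w)).1`, `c_a = g_a'(w₀) ≠ 0`, `d_a = −(g_a''(w₀)/2)/c_a²`,
`P_a ξ' = V a (w₀ + ξ'⁻¹)` (`ξ' ≠ 0`), `P_a 0 = U a 0`; then
`Floc b ξ = inPInv (P_a (c_a (ξ − d_a)))` (`PencilEnd.leafParam`, `leafCoeff`, `leafJoint`,
`leafMember`, `LeafLaurent.tendsto_inv_sub_inv`). In the blow-up coordinates at infinity,
`famXW p Floc (b, η) = boxCoord (V a (w₀ + η / (c_a (1 − d_a η))))` for ALL small `η` (including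
`η = 0`), a composition of `C^∞` maps; the uniform radius `rI` on `ball b₀ (δ/2)` comes from the
generalized tube lemma.

## References

* C. Wendl, *Holomorphic Curves in Low Dimensions*, LNM 2216 (2018), proof of Prop. 2.53. [Wendl2018]
-/

noncomputable section

open scoped Manifold ContDiff Topology
open Set Function Filter Metric Complex Literature.Topology.FourManifolds

namespace Literature.Geometry.Symplectic

namespace PencilEnd

variable {M : Type} [TopologicalSpace M] [ChartedSpace (EuclideanSpace ℝ (Fin 4)) M] [T2Space M]
  [SecondCountableTopology M] [CompactSpace M] [IsManifold (𝓡 4) ∞ M] {p : M} (G : PencilEnd p)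
  (J : ∀ x : punctured p, TangentSpace (𝓡 4) x →L[ℝ] TangentSpace (𝓡 4) x)

/-- The reparametrised puncture coordinate: for `η ≠ 0` with `1 - d η ≠ 0`,
`(c (η⁻¹ - d))⁻¹ = η / (c (1 - d η))`. [folklore] -/
theorem inv_affine_inv {c d η : ℂ} (hη : η ≠ 0) (hc : c ≠ 0) :
    (c * (η⁻¹ - d))⁻¹ = η / (c * (1 - d * η)) := by
  have h : c * (η⁻¹ - d) = c * (1 - d * η) / η := by field_simp
  rw [h, inv_div]

/-- **The local family of pencil members read off from the leaves** (see the module docstring).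
[cite: Wendl2018, proof of Prop. 2.53 (p. 65)] -/
theorem exists_leafFloc
    (hJstd : ∀ x : punctured p, InPuncturedChartBall p G.rad x →
      ∀ (v : TangentSpace (𝓡 4) x) (c : EuclideanSpace ℝ (Fin 4)),
        inner ℝ (fderiv ℝ inversion (extChartAt (𝓡 4) p x.1 - extChartAt (𝓡 4) p p)
          (mfderiv (𝓡 4) 𝓘(ℝ, EuclideanSpace ℝ (Fin 4))
            (fun z : punctured p => extChartAt (𝓡 4) p z.1) x (J x v))) c
        = stdSymplecticForm (fderiv ℝ inversion (extChartAt (𝓡 4) p x.1 - extChartAt (𝓡 4) p p)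
          (mfderiv (𝓡 4) 𝓘(ℝ, EuclideanSpace ℝ (Fin 4))
            (fun z : punctured p => extChartAt (𝓡 4) p z.1) x v)) c)
    {u₀ : ℂ → punctured p} {b₀ : ℂ} (hu₀ : IsPencilPlane J u₀ b₀) (hb₀ : ‖b₀ - G.b₀‖ < G.ρ')
    {ε : ℝ} {U V : ℂ → ℂ → G.Y} (hε : 0 < ε)
    (hU0 : ∀ z, U 0 z = G.memberU u₀ z) (hV0 : ∀ w, V 0 w = G.memberV u₀ b₀ w)
    (hleaf : ∀ a : ℂ, ‖a‖ < ε →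
      ContMDiff 𝓘(ℝ, ℂ) (𝓡 4) ∞ (U a) ∧ ContMDiff 𝓘(ℝ, ℂ) (𝓡 4) ∞ (V a) ∧
      (∀ z : ℂ, z ≠ 0 → V a z = U a z⁻¹) ∧
      IsJHolomorphic (𝓡 4) (fun y => G.JY J y) (U a) ∧
      IsJHolomorphic (𝓡 4) (fun y => G.JY J y) (V a) ∧
      Injective (U a) ∧ (∀ z, Injective (mfderiv 𝓘(ℝ, ℂ) (𝓡 4) (U a) z)) ∧
      Injective (mfderiv 𝓘(ℝ, ℂ) (𝓡 4) (V a) 0) ∧ V a 0 ∉ range (U a))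
    (hUfam : ContMDiffOn 𝓘(ℝ, ℂ × ℂ) (𝓡 4) ∞ (fun q : ℂ × ℂ => U q.1 q.2) (ball 0 ε ×ˢ univ))
    (hVfam : ContMDiffOn 𝓘(ℝ, ℂ × ℂ) (𝓡 4) ∞ (fun q : ℂ × ℂ => V q.1 q.2) (ball 0 ε ×ˢ univ))
    (hinj : ∀ q ∈ ball (0 : ℂ) ε ×ˢ (univ : Set ℂ),
      Injective (mfderiv 𝓘(ℝ, ℂ × ℂ) (𝓡 4) (fun q : ℂ × ℂ => U q.1 q.2) q) ∧
      Injective (mfderiv 𝓘(ℝ, ℂ × ℂ) (𝓡 4) (fun q : ℂ × ℂ => V q.1 q.2) q)) :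
    ∃ (δ' : ℝ) (Floc : ℂ → ℂ → punctured p), 0 < δ' ∧ Floc b₀ = u₀ ∧
      (∀ b ∈ ball b₀ δ', IsPencilPlane J (Floc b) b) ∧
      ContMDiffOn 𝓘(ℝ, ℂ × ℂ) (𝓡 4) ∞ (fun q : ℂ × ℂ => Floc q.1 q.2)
        ((ball b₀ δ') ×ˢ (univ : Set ℂ)) ∧
      (∀ q : ℂ × ℂ, q.1 ∈ ball b₀ δ' →
        Injective (mfderiv 𝓘(ℝ, ℂ × ℂ) (𝓡 4) (fun q : ℂ × ℂ => Floc q.1 q.2) q)) ∧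
      (∃ rI : ℝ, 0 < rI ∧
        (∀ b ∈ ball b₀ δ', ∀ η : ℂ, η ≠ 0 → ‖η‖ < rI →
          InPuncturedChartBall p G.rad (Floc b η⁻¹) ∧ 1 < ‖(pencilCoord p (Floc b η⁻¹)).1‖) ∧
        ContDiffOn ℝ ∞ (famXW p Floc) (ball b₀ δ' ×ˢ ball 0 rI)) ∧
      (∀ b ∈ ball b₀ δ', ∃ a : ℂ, ‖a‖ < ε ∧
        range (G.inP ∘ Floc b) = (range (U a) ∪ {V a 0}) ∩ range G.inP) := by
  -- the intercept chart
  obtain ⟨ε₁, r₁, r₂, δ, wz, α, β, hε₁, hε₁ε, hr₁, hr₁r₂, hr₂, hδ, hwzs, hwz0, hwzr, hVcap, hVE, hUP,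
      hholo, hderiv, hVwz, hbc, hβs, hβ0, hβρ, hαs, hα0, hαβ, hβα, hαbij⟩ :=
    G.exists_interceptChart J hJstd hu₀ hb₀ hε hU0 hV0
      (fun a ha => ⟨(hleaf a ha).2.2.1, (hleaf a ha).2.2.2.1, (hleaf a ha).2.2.2.2.1⟩) hUfam hVfam hinj
  -- the renormalisation constants of the leaf `a`
  obtain ⟨cf, hcf⟩ : ∃ cf : ℂ → ℂ, ∀ a, cf a = deriv (fun w => (G.boxCoord (V a w)).1) (wz a) :=
    ⟨_, fun _ => rfl⟩
  obtain ⟨ef, hef⟩ : ∃ ef : ℂ → ℂ,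
      ∀ a, ef a = deriv (deriv (fun w => (G.boxCoord (V a w)).1)) (wz a) := ⟨_, fun _ => rfl⟩
  obtain ⟨df, hdf⟩ : ∃ df : ℂ → ℂ, ∀ a, df a = -(ef a / 2) / (cf a) ^ 2 := ⟨_, fun _ => rfl⟩
  -- the puncture parametrisations of the leaves and the family
  obtain ⟨P, hP⟩ : ∃ P : ℂ → ℂ → G.Y,
      ∀ a ξ', P a ξ' = if ξ' = 0 then U a 0 else V a (wz a + ξ'⁻¹) := ⟨_, fun _ _ => rfl⟩
  have hPne : ∀ a ξ' : ℂ, ξ' ≠ 0 → P a ξ' = V a (wz a + ξ'⁻¹) := fun a ξ' h => by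
    rw [hP, if_neg h]
  have hP0 : ∀ a : ℂ, P a 0 = U a 0 := fun a => by rw [hP, if_pos rfl]
  obtain ⟨Floc, hFloc⟩ : ∃ Floc : ℂ → ℂ → punctured p,
      ∀ b ξ, Floc b ξ = G.inPInv (P (α b) (cf (α b) * (ξ - df (α b)))) := ⟨_, fun _ _ => rfl⟩
  -- elementary bookkeeping
  have ha : ∀ b ∈ ball b₀ δ, α b ∈ ball (0 : ℂ) ε₁ := fun b hb => (hαβ b hb).1
  have ha' : ∀ b ∈ ball b₀ δ, ‖α b‖ < ε := fun b hb => by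
    have h := ha b hb
    rw [Metric.mem_ball, dist_zero_right] at h
    exact h.trans_le hε₁ε
  have hwz2 : ∀ a ∈ ball (0 : ℂ) ε₁, ‖wz a‖ < r₂ / 2 := fun a h => (hwzr a h).trans_le hr₁r₂
  have hwzr₂ : ∀ a ∈ ball (0 : ℂ) ε₁, ‖wz a‖ < r₂ := fun a h => (hwz2 a h).trans (by linarith)
  have hcf0 : ∀ a ∈ ball (0 : ℂ) ε₁, cf a ≠ 0 := fun a h => by rw [hcf]; exact hderiv a h
  -- the set-theoretic properties of the puncture parametrisations
  have hparam : ∀ b ∈ ball b₀ δ,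
      (∀ ξ' : ℂ, 1 + wz (α b) * ξ' ≠ 0 → P (α b) ξ' = U (α b) (ξ' / (1 + wz (α b) * ξ'))) ∧
      (∀ ξ' : ℂ, P (α b) ξ' ∈ range G.inP) ∧
      range (P (α b)) = (range (U (α b)) ∪ {V (α b) 0}) ∩ range G.inP ∧
      Injective (P (α b)) ∧
      (∀ w : ℂ, ‖w‖ ≤ r₂ → w ≠ wz (α b) → (G.boxCoord (V (α b) w)).1 ≠ 0 ∧
        ∃ x : punctured p, x ∈ G.src ∧ G.inP x = V (α b) w ∧
          pencilCoord p x = (((G.boxCoord (V (α b) w)).1)⁻¹, (G.boxCoord (V (α b) w)).2)) := by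
    intro b hb
    obtain ⟨-, -, hUVa, -, -, hUinj, -, -, hV0a⟩ := hleaf (α b) (ha' b hb)
    exact G.leafParam hr₂ hUVa hUinj hV0a (hVcap _ (ha b hb)) (hVE _ (ha b hb)) (hUP _ (ha b hb))
      (hwz2 _ (ha b hb)) (hPne (α b)) (hP0 (α b))
  have hιF : ∀ b ∈ ball b₀ δ, ∀ ξ : ℂ,
      G.inP (Floc b ξ) = P (α b) (cf (α b) * (ξ - df (α b))) := by
    intro b hb ξ
    rw [hFloc]
    exact G.inP_inPInv ((hparam b hb).2.1 _)
  -- smoothness of the constants in the leaf parameter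
  obtain ⟨hc1, hc2⟩ := G.leafCoeff hVfam hε₁ε hwzs hwzr₂ hVcap hholo
  have hcfs : ContDiffOn ℝ ∞ cf (ball 0 ε₁) := hc1.congr fun a _ => hcf a
  have hefs : ContDiffOn ℝ ∞ ef (ball 0 ε₁) := hc2.congr fun a _ => hef a
  have hdfs : ContDiffOn ℝ ∞ df (ball 0 ε₁) := by
    have h : ContDiffOn ℝ ∞ (fun a => -(ef a / 2) * ((cf a) ^ 2)⁻¹) (ball 0 ε₁) :=
      (hefs.div_const 2).neg.mul ((hcfs.pow 2).inv fun a h => pow_ne_zero 2 (hcf0 a h))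
    exact h.congr fun a _ => by rw [hdf, div_eq_mul_inv]
  -- joint smoothness and injective differential
  have hBform : ∀ b ∈ ball b₀ δ, ∀ ξ : ℂ, cf (α b) * (ξ - df (α b)) ≠ 0 →
      G.inP (Floc b ξ) = V (α b) (wz (α b) + (cf (α b) * (ξ - df (α b)))⁻¹) :=
    fun b hb ξ hne => by rw [hιF b hb ξ, hPne _ _ hne]
  obtain ⟨hΦs, hΦinj, hsl, hsl'⟩ := G.leafJoint hUfam hVfam hinj hε₁ε hwzs hcfs hdfs hcf0 hαs ha
    hαbij (fun b hb ξ hne => by rw [hιF b hb ξ, (hparam b hb).1 _ hne]) hBform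
  -- each `Floc b` is a member of intercept `b` with the stated range
  have hmem : ∀ b ∈ ball b₀ δ, IsPencilPlane J (Floc b) b ∧
      range (G.inP ∘ Floc b) = (range (U (α b)) ∪ {V (α b) 0}) ∩ range G.inP := by
    intro b hb
    obtain ⟨hUsm, hVsm, -, hUj, hVj, -, -, -, -⟩ := hleaf (α b) (ha' b hb)
    obtain ⟨hPU, -, hrange, hPinj, hflat⟩ := hparam b hb
    have hcc0 : G.boxCoord (V (α b) (wz (α b))) = (0, b) := by rw [hbc _ (ha b hb), (hαβ b hb).2]
    have hVw₀P : V (α b) (wz (α b)) ∉ range G.inP := (hVE _ (ha b hb) _ (hwzr₂ _ (ha b hb)).le).2 rfl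
    -- the Laurent asymptotics of the `x'`-coordinate of the leaf at its simple zero `wz (α b)`
    have hw₀b : wz (α b) ∈ ball (0 : ℂ) r₂ := mem_ball_zero_iff.2 (hwzr₂ _ (ha b hb))
    have hg0 : (G.boxCoord (V (α b) (wz (α b)))).1 = 0 := by rw [hcc0]
    have hL := LeafLaurent.tendsto_inv_sub_inv (fun w => (G.boxCoord (V (α b) w)).1) (ball 0 r₂)
      (wz (α b)) isOpen_ball hw₀b (hholo _ (ha b hb)).fst hg0 (hderiv _ (ha b hb))
    rw [← hcf, ← hef, ← hdf] at hL
    exact G.leafMember J hr₂ hUsm hVsm hUj hVj (hholo _ (ha b hb)) (hcf0 _ (ha b hb)) hL hcc0 hVw₀P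
      (hwz2 _ (ha b hb)) (hPne (α b)) hPU hrange hPinj hflat (hιF b hb) (hsl b hb) (hsl' b hb)
  -- `Floc b₀ = u₀`
  have hFloc0 : Floc b₀ = u₀ := by
    have hb₀δ : b₀ ∈ ball b₀ δ := mem_ball_self hδ
    obtain ⟨hmem0, hrange0⟩ := hmem b₀ hb₀δ
    rw [hα0] at hrange0
    have hU0r : range (U 0) = G.inP '' range u₀ := by
      ext y
      constructor
      · rintro ⟨z, rfl⟩
        rw [hU0, memberU_apply]
        exact ⟨_, ⟨_, rfl⟩, rfl⟩
      · rintro ⟨_, ⟨ξ, rfl⟩, rfl⟩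
        exact ⟨ξ, by rw [hU0, memberU_apply]⟩
    have hV00 : V 0 0 ∉ range G.inP := by
      rw [hV0, memberV_zero, G.inBox_of_mem (G.zero_intercept_mem_box hb₀)]
      exact G.inB_notMem_range_inP rfl
    have hR : (range (U 0) ∪ {V 0 0}) ∩ range G.inP = G.inP '' range u₀ := by
      rw [hU0r]
      apply Subset.antisymm
      · rintro y ⟨hy | hy, hyP⟩
        · exact hy
        · exfalso
          rw [mem_singleton_iff] at hy
          rw [hy] at hyP
          exact hV00 hyP
      · intro y hy
        refine ⟨Or.inl hy, ?_⟩
        obtain ⟨x, -, rfl⟩ := hy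
        exact ⟨x, rfl⟩
    rw [hR, range_comp] at hrange0
    have hreq : range (Floc b₀) = range u₀ := (image_eq_image G.injective_inP).1 hrange0
    exact hmem0.eq_of_range_eq hu₀ hreq
  /- The blow-up regularity at infinity (clause `hE` of the reduction): on `ball b₀ (δ/2)`,
  `famXW p Floc (b, η) = boxCoord (V a (wz a + s (b, η)))`, `s (b, η) = η / (cf a (1 - df a η))`,
  `a = α b`, for all small `η`. -/
  -- the joint box-coordinate map of the leaves and the reparametrisation
  set Gb : ℂ × ℂ → ℂ × ℂ := fun q => G.boxCoord (V q.1 q.2) with hGb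
  set OD : Set (ℂ × ℂ) := ball (0 : ℂ) ε₁ ×ˢ ball (0 : ℂ) r₂ with hOD
  have hODo : IsOpen OD := isOpen_ball.prod isOpen_ball
  have hGbs : ContDiffOn ℝ ∞ Gb OD := by
    have h1 : ContMDiffOn 𝓘(ℝ, ℂ × ℂ) (𝓡 4) ∞ (fun q : ℂ × ℂ => V q.1 q.2) OD :=
      hVfam.mono (prod_mono (ball_subset_ball hε₁ε) (subset_univ _))
    have h2 : ContMDiffOn 𝓘(ℝ, ℂ × ℂ) 𝓘(ℝ, ℂ × ℂ) ∞ Gb OD :=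
      G.contMDiffOn_boxCoord.comp h1 fun q hq =>
        hVcap q.1 (mem_prod.1 hq).1 q.2 (mem_ball_zero_iff.1 (mem_prod.1 hq).2).le
    exact h2.contDiffOn
  set sf : ℂ × ℂ → ℂ := fun q => q.2 / (cf (α q.1) * (1 - df (α q.1) * q.2)) with hsf
  set Θ : ℂ × ℂ → ℂ × ℂ := fun q => (α q.1, wz (α q.1) + sf q) with hΘ
  -- the domain where the reparametrisation is meaningful
  set W₀ : Set (ℂ × ℂ) := {q | q.1 ∈ ball b₀ δ ∧ ‖df (α q.1) * q.2‖ < 2⁻¹ ∧ ‖sf q‖ < r₂ / 2}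
    with hW₀
  have hW₀1 : ∀ q ∈ W₀, q.1 ∈ ball b₀ δ := fun q hq => hq.1
  have hden : ∀ q ∈ W₀, 1 - df (α q.1) * q.2 ≠ 0 := by
    intro q hq h0
    have h := hq.2.1
    have : df (α q.1) * q.2 = 1 := by linear_combination -h0
    rw [this, norm_one] at h
    norm_num at h
  have hden' : ∀ q ∈ W₀, cf (α q.1) * (1 - df (α q.1) * q.2) ≠ 0 := fun q hq =>
    mul_ne_zero (hcf0 _ (ha _ hq.1)) (hden q hq)
  -- smoothness of the coefficient maps on `ball b₀ δ ×ˢ univ`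
  set Ω : Set (ℂ × ℂ) := ball b₀ δ ×ˢ (univ : Set ℂ) with hΩ
  have hΩo : IsOpen Ω := isOpen_ball.prod isOpen_univ
  have hαq : ContDiffOn ℝ ∞ (fun q : ℂ × ℂ => α q.1) Ω :=
    hαs.comp contDiffOn_fst fun q hq => (mem_prod.1 hq).1
  have hαq' : ∀ q ∈ Ω, α q.1 ∈ ball (0 : ℂ) ε₁ := fun q hq => ha _ (mem_prod.1 hq).1
  have hcfq : ContDiffOn ℝ ∞ (fun q : ℂ × ℂ => cf (α q.1)) Ω := hcfs.comp hαq hαq'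
  have hdfq : ContDiffOn ℝ ∞ (fun q : ℂ × ℂ => df (α q.1)) Ω := hdfs.comp hαq hαq'
  have hwzq : ContDiffOn ℝ ∞ (fun q : ℂ × ℂ => wz (α q.1)) Ω := hwzs.comp hαq hαq'
  have hdenq : ContDiffOn ℝ ∞ (fun q : ℂ × ℂ => cf (α q.1) * (1 - df (α q.1) * q.2)) Ω :=
    hcfq.mul (contDiffOn_const.sub (hdfq.mul contDiffOn_snd))
  have hW₀Ω : W₀ ⊆ Ω := fun q hq => ⟨hq.1, mem_univ _⟩
  -- `W₀` is open
  have hW₀o : IsOpen W₀ := by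
    -- first the open set where the denominator condition holds
    set W₁ : Set (ℂ × ℂ) := {q | q.1 ∈ ball b₀ δ ∧ ‖df (α q.1) * q.2‖ < 2⁻¹} with hW₁
    have hW₁o : IsOpen W₁ := by
      have h : W₁ = Ω ∩ (fun q => ‖df (α q.1) * q.2‖) ⁻¹' Iio 2⁻¹ := by
        ext q; simp only [hW₁, hΩ, mem_setOf_eq, mem_inter_iff, mem_prod, mem_univ, and_true,
          mem_preimage, mem_Iio]
      rw [h]
      exact ((hdfq.mul contDiffOn_snd).continuousOn.norm).isOpen_inter_preimage hΩo isOpen_Iio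
    have hW₁Ω : W₁ ⊆ Ω := fun q hq => ⟨hq.1, mem_univ _⟩
    have hsfc : ContinuousOn sf W₁ := by
      refine (continuousOn_snd.div (hdenq.continuousOn.mono hW₁Ω) fun q hq => ?_)
      refine mul_ne_zero (hcf0 _ (ha _ hq.1)) fun h0 => ?_
      have h := hq.2
      have : df (α q.1) * q.2 = 1 := by linear_combination -h0
      rw [this, norm_one] at h
      norm_num at h
    have h : W₀ = W₁ ∩ (fun q => ‖sf q‖) ⁻¹' Iio (r₂ / 2) := by
      ext q
      simp only [hW₀, hW₁, mem_setOf_eq, mem_inter_iff, mem_preimage, mem_Iio, and_assoc]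
    rw [h]
    exact hsfc.norm.isOpen_inter_preimage hW₁o isOpen_Iio
  have hsfs : ContDiffOn ℝ ∞ sf W₀ := by
    have h : ContDiffOn ℝ ∞ (fun q : ℂ × ℂ => q.2 * (cf (α q.1) * (1 - df (α q.1) * q.2))⁻¹) W₀ :=
      contDiffOn_snd.mul (((hdenq.mono hW₀Ω)).inv hden')
    exact h.congr fun q _ => by simp only [hsf, div_eq_mul_inv]
  have hΘs : ContDiffOn ℝ ∞ Θ W₀ :=
    (hαq.mono hW₀Ω).prodMk ((hwzq.mono hW₀Ω).add hsfs)
  have hΘOD : MapsTo Θ W₀ OD := by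
    intro q hq
    refine mk_mem_prod (ha _ hq.1) (mem_ball_zero_iff.2 ?_)
    calc ‖wz (α q.1) + sf q‖ ≤ ‖wz (α q.1)‖ + ‖sf q‖ := norm_add_le _ _
      _ < r₂ / 2 + r₂ / 2 := add_lt_add (hwz2 _ (ha _ hq.1)) hq.2.2
      _ = r₂ := by ring
  have hGΘs : ContDiffOn ℝ ∞ (Gb ∘ Θ) W₀ := hGbs.comp hΘs hΘOD
  -- the key identity: for `η ≠ 0`, `Floc b η⁻¹` is the point of the gluing region under
  -- `V a (wz a + sf (b, η))`, with flat coordinates read off the box coordinates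
  have hkey : ∀ q ∈ W₀, q.2 ≠ 0 →
      ∃ x : punctured p, x ∈ G.src ∧ Floc q.1 q.2⁻¹ = x ∧
        pencilCoord p x = (((Gb (Θ q)).1)⁻¹, (Gb (Θ q)).2) ∧ (Gb (Θ q)).1 ≠ 0 := by
    intro q hq hη
    have hb := hq.1
    set a := α q.1 with hadef
    have hsfq : sf q = (cf a * (q.2⁻¹ - df a))⁻¹ := by
      rw [hsf]
      exact (inv_affine_inv hη (hcf0 _ (ha _ hb))).symm
    have hsne : cf a * (q.2⁻¹ - df a) ≠ 0 := by
      intro h0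
      have : sf q = 0 := by rw [hsfq, h0, inv_zero]
      have h2 : q.2 = 0 := by
        rw [hsf] at this
        exact (div_eq_zero_iff.1 this).resolve_right (hden' q hq)
      exact hη h2
    have hsf0 : sf q ≠ 0 := by rw [hsfq]; exact inv_ne_zero hsne
    have hVpt : G.inP (Floc q.1 q.2⁻¹) = V a (wz a + sf q) := by
      rw [hBform q.1 hb _ hsne, hsfq]
    have hw : ‖wz a + sf q‖ ≤ r₂ := (mem_ball_zero_iff.1 (mem_prod.1 (hΘOD hq)).2).le
    have hwne : wz a + sf q ≠ wz a := fun h => hsf0 (by simpa using h)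
    obtain ⟨h1, x, hx, hxV, hY⟩ := (hparam q.1 hb).2.2.2.2 (wz a + sf q) hw hwne
    refine ⟨x, hx, G.injective_inP (hVpt.trans hxV.symm), hY, h1⟩
  -- `famXW p Floc = Gb ∘ Θ` on `W₀`
  have hfam : ∀ q ∈ W₀, famXW p Floc q = Gb (Θ q) := by
    intro q hq
    by_cases hη : q.2 = 0
    · have hq' : q = (q.1, 0) := Prod.ext rfl hη
      rw [hq', famXW_zero]
      show ((0 : ℂ), q.1) = G.boxCoord (V (α q.1) (wz (α q.1) + sf (q.1, 0)))
      have hs0 : sf (q.1, 0) = 0 := by simp [hsf]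
      rw [hs0, add_zero, hbc _ (ha _ hq.1), (hαβ q.1 hq.1).2]
    · obtain ⟨x, -, hFx, hY, -⟩ := hkey q hq hη
      have hq' : q = (q.1, q.2) := rfl
      rw [hq', famXW_of_ne_zero Floc hη, hFx, hY]
      simp
  -- the uniform radius on `ball b₀ (δ/2)`: generalized tube lemma
  set W : Set (ℂ × ℂ) := W₀ ∩ (Gb ∘ Θ) ⁻¹' {z | ‖z.1‖ < 1} with hW
  have hWo : IsOpen W :=
    hGΘs.continuousOn.isOpen_inter_preimage hW₀o (isOpen_lt (continuous_fst.norm) continuous_const)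
  have hKW : closedBall b₀ (δ / 2) ×ˢ ({0} : Set ℂ) ⊆ W := by
    rintro ⟨b, η⟩ ⟨hb, hη⟩
    rw [mem_singleton_iff] at hη
    subst hη
    have hbδ : b ∈ ball b₀ δ := closedBall_subset_ball (by linarith) hb
    have hs0 : sf (b, 0) = 0 := by simp [hsf]
    have hq : (b, (0 : ℂ)) ∈ W₀ := by
      refine ⟨hbδ, ?_, ?_⟩
      · show ‖df (α b) * 0‖ < 2⁻¹
        rw [mul_zero, norm_zero]; norm_num
      · rw [hs0, norm_zero]; positivity
    refine ⟨hq, ?_⟩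
    show ‖(Gb (Θ (b, 0))).1‖ < 1
    rw [← hfam _ hq, famXW_zero]
    simp
  obtain ⟨uu, vv, huo, hvo, hKu, h0v, huv⟩ :=
    generalized_tube_lemma (isCompact_closedBall b₀ (δ / 2)) isCompact_singleton hWo hKW
  obtain ⟨rI, hrI, hrIv⟩ := Metric.isOpen_iff.1 hvo 0 (h0v (mem_singleton 0))
  set δ' : ℝ := δ / 2 with hδ'
  have hδ'δ : ball b₀ δ' ⊆ ball b₀ δ := ball_subset_ball (by rw [hδ']; linarith)
  have hsubW : ball b₀ δ' ×ˢ ball (0 : ℂ) rI ⊆ W := fun q hq =>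
    huv ⟨hKu (ball_subset_closedBall (mem_prod.1 hq).1), hrIv (mem_prod.1 hq).2⟩
  refine ⟨δ', Floc, by positivity, hFloc0, fun b hb => (hmem b (hδ'δ hb)).1,
    hΦs.mono (prod_mono hδ'δ Subset.rfl), fun q hq => hΦinj q (hδ'δ hq), ⟨rI, hrI, ?_, ?_⟩,
    fun b hb => ⟨α b, ha' b (hδ'δ hb), (hmem b (hδ'δ hb)).2⟩⟩
  · -- the uniform standard end with `‖z‖ > 1`
    intro b hb η hη hηr
    have hqW : (b, η) ∈ W := hsubW (mk_mem_prod hb (mem_ball_zero_iff.2 hηr))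
    obtain ⟨x, hx, hFx, hY, h1⟩ := hkey (b, η) hqW.1 hη
    have hlt : ‖(Gb (Θ (b, η))).1‖ < 1 := hqW.2
    rw [hFx, hY]
    refine ⟨hx.1, ?_⟩
    simp only [norm_inv]
    exact (one_lt_inv₀ (norm_pos_iff.2 h1)).2 hlt
  · -- smoothness of the blow-up coordinates
    exact (hGΘs.mono fun q hq => (hsubW hq).1).congr fun q hq => hfam q (hsubW hq).1

end PencilEnd

end Literature.Geometry.Symplectic
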